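import Summits.Ventures.LatticeQCDFlow.Exactness.IMHCoupledUnbiasedEstimator
import HarnessLib

/-!
# The coupled unbiased estimator at second order: the summed common-random-numbers corrections have second moment
# `≤ (1 − A)^k (c − a)² (2 − A)/A²`, and the truncated estimator `f(Y_k) + Σ_{n<N} D_{k+n}` has mean EXACTLY `E f(Y_{k+N})`

HONEST FRAMING: exact (Metropolis-corrected) sampling algorithms for lattice gauge theory;
figures of merit are autocorrelation/cost numbers at stated couplings and volumes; no
continuum-physics claim.

Venture `LatticeQCDFlow` (cell pub-lqcd), topic `Exactness`; FANOUT row 30 (lean-1, GEN-37).  NEW WORK of the cell,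
general state space; sequel to `Exactness/IMHCoupledUnbiasedEstimator` (GEN-36), whose «NOT CLAIMED: the variance of `H_k`»
is removed here.  Setting as there: `K = indepMH q w` (`w` measurable — a `Fact` —, positive, normalised, maximal at `x₀`;
`W = w(x₀) = 1/A`, `r = 1 − A`), a CRN pair kernel `K̂` (two runs fed the same proposals and uniforms), the pair path law
`P̂_{μ̂₀}` from an initial coupling `μ̂₀` (`μ₂ = μ̂₀∘snd⁻¹`), the corrections `D_n = f(X′_n) − f(Y_n)` for a measurable
`a ≤ f ≤ c`.  ONLY the first-moment envelope `E|D_n| ≤ rⁿ(c − a)` of GEN-36 and boundedness are used — no diagonal, no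
measurability of «the runs have met»:

* §0 arithmetic (**`sum_sum_pow_max_eq`**, **`sum_sum_pow_max_le`**): `Σ_{i,j<N} r^{max(i,j)} = Σ_{m<N}(2m + 1)r^m ≤ (1 + r)/(1 − r)²`.
* §1 **`crnLag_integral_abs_mul_abs_le`** — `E[|D_i|·|D_j|] ≤ r^{max(i,j)}·(c − a)²` (bound the earlier factor by `c − a`,
  the later one by its envelope); **`crnLag_integral_sq_sum_abs_le`** — THE SECOND MOMENT OF THE SUMMED CORRECTIONS:
  `E[(Σ_{n<N}|D_{k+n}|)²] ≤ r^k·(c − a)²·W(2W − 1)` for every `N` (`W(2W − 1) = (1 + r)/(1 − r)² = (2 − A)/A²`), uniformly in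
  `N`, from EVERY initial coupling; **`crnLag_integral_sq_sum_le`** — the same for `(Σ_{n<N} D_{k+n})²`.
* §2 the TRUNCATED ESTIMATOR `H_{k,N} = f(Y_k) + Σ_{n<N} D_{k+n}` under the lag condition `μ̂₀∘fst⁻¹ = μ₂K`:
  **`crnLag_truncated_integral_eq`** — `E H_{k,N} = (μ₂K^{k+N}) f = E f(Y_{k+N})` EXACTLY: `N` corrections move the burn-in
  bias of `f(Y_k)` to that of `f(Y_{k+N})`; **`crnLag_truncated_bias_mem_Icc`** — so `E H_{k,N} − π(f) ∈ r^{k+N}·[a − π(f),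
  c − π(f)]` and (**`crnLag_truncated_bias_abs_le`**) `|E H_{k,N} − π(f)| ≤ r^{k+N}·(c − a)`; the `N = ∞` estimator is exactly
  unbiased (GEN-36).
The mean-square error `E(H_{k,N} − π(f))² ≤ E(f(Y_k) − π(f))² + r^k·(c − a)²·W(2W + 1)` and its any-start envelope are the
sequel `Exactness/IMHCoupledUnbiasedEstimatorMSE`.
Reading (gauge files): the random correction that removes ALL the burn-in bias has second moment at most
`(1 − A)^k (c − a)² (2 − A)/A²` — geometrically small in the lag `k` — and `N` corrections leave exactly the bias of time `k + N`.
NOT CLAIMED: the exact variance; optimality of the constant `W(2W − 1)`; the time-averaged estimator (a later file);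
anything for unbounded `f`.  No `sorry`, no new definitions, nothing cited as a fact (printed counterpart, named only:
Glynn–Rhee ∕ Jacob–O'Leary–Atchadé, whose variance bounds assume a geometric tail of the meeting time — here it is proved).
-/

noncomputable section

namespace Summit.Ventures.LatticeQCDFlow.Exactness

open MeasureTheory ProbabilityTheory Function Finset
open scoped ENNReal unitInterval
open Summit.Ventures.LatticeQCDFlow.Scoring

variable {Ω : Type*} [MeasurableSpace Ω] {q : Measure Ω} [IsProbabilityMeasure q] {w : Ω → ℝ}

/-! ## §0 Arithmetic: the double geometric sum `Σ_{i,j<N} r^{max(i,j)}` -/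

omit [MeasurableSpace Ω] in
/-- `Σ_{i<N} Σ_{j<N} r^{max(i,j)} = Σ_{m<N} (2m + 1)·r^m`. [ours, bookkeeping] -/
theorem sum_sum_pow_max_eq (r : ℝ) (N : ℕ) :
    ∑ i ∈ range N, ∑ j ∈ range N, r ^ max i j = ∑ m ∈ range N, (2 * (m : ℝ) + 1) * r ^ m := by
  induction N with
  | zero => simp
  | succ N ih =>
    have key : ∑ i ∈ range (N + 1), ∑ j ∈ range (N + 1), r ^ max i j =
        ∑ i ∈ range N, ∑ j ∈ range N, r ^ max i j + (2 * (N : ℝ) + 1) * r ^ N := by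
      rw [sum_range_succ]
      have hA : ∑ i ∈ range N, ∑ j ∈ range (N + 1), r ^ max i j =
          ∑ i ∈ range N, ∑ j ∈ range N, r ^ max i j + (N : ℝ) * r ^ N := by
        have h : ∀ i ∈ range N, ∑ j ∈ range (N + 1), r ^ max i j = ∑ j ∈ range N, r ^ max i j + r ^ N := by
          intro i hi
          rw [sum_range_succ, max_eq_right (mem_range.1 hi).le]
        rw [sum_congr rfl h, sum_add_distrib, sum_const, card_range, nsmul_eq_mul]
      have hB : ∑ j ∈ range (N + 1), r ^ max N j = (N : ℝ) * r ^ N + r ^ N := by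
        rw [sum_range_succ, max_self]
        have h : ∀ j ∈ range N, r ^ max N j = r ^ N := by
          intro j hj
          rw [max_eq_left (mem_range.1 hj).le]
        rw [sum_congr rfl h, sum_const, card_range, nsmul_eq_mul]
      rw [hA, hB]
      ring
    rw [key, ih, sum_range_succ]

omit [MeasurableSpace Ω] in
/-- For `0 ≤ r < 1`: `Σ_{i<N} Σ_{j<N} r^{max(i,j)} ≤ (1 + r)/(1 − r)²` (`= Σ_{m ≥ 0}(2m + 1)r^m`). [ours, bookkeeping] -/
theorem sum_sum_pow_max_le {r : ℝ} (hr0 : 0 ≤ r) (hr1 : r < 1) (N : ℕ) :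
    ∑ i ∈ range N, ∑ j ∈ range N, r ^ max i j ≤ (1 + r) / (1 - r) ^ 2 := by
  rw [sum_sum_pow_max_eq]
  have hn : ‖r‖ < 1 := by rwa [Real.norm_of_nonneg hr0]
  have h1 : HasSum (fun m : ℕ => (m : ℝ) * r ^ m) (r / (1 - r) ^ 2) := hasSum_coe_mul_geometric_of_norm_lt_one hn
  have h2 : HasSum (fun m : ℕ => r ^ m) (1 - r)⁻¹ := hasSum_geometric_of_lt_one hr0 hr1
  have hfun : (fun m : ℕ => (2 * (m : ℝ) + 1) * r ^ m) = fun m : ℕ => 2 * ((m : ℝ) * r ^ m) + r ^ m := by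
    funext m
    ring
  have h : HasSum (fun m : ℕ => (2 * (m : ℝ) + 1) * r ^ m) (2 * (r / (1 - r) ^ 2) + (1 - r)⁻¹) := by
    rw [hfun]
    exact (h1.mul_left 2).add h2
  have hle := sum_le_hasSum (range N) (fun m _ => mul_nonneg (by positivity) (pow_nonneg hr0 m)) h
  refine hle.trans_eq ?_
  have h1r : (1 - r) ≠ 0 := (sub_pos.2 hr1).ne'
  field_simp
  ring

/-! ## §1 The second moment of the summed corrections -/

/-- **`E[|D_i|·|D_j|] ≤ r^{max(i,j)}·(c − a)²`** for the CRN corrections `D_n = f(X′_n) − f(Y_n)`, `a ≤ f ≤ c`, from every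
initial coupling. [ours] -/
theorem crnLag_integral_abs_mul_abs_le [Fact (Measurable w)] (hw0 : ∀ y, 0 < w y) {x₀ : Ω} (hmax : ∀ y, w y ≤ w x₀)
    [IsProbabilityMeasure (q.withDensity fun y => ENNReal.ofReal (w y))]
    (Khat : Kernel (Ω × Ω) (Ω × Ω)) [IsMarkovKernel Khat]
    (hK : ∀ z : Ω × Ω, Khat z = (q.prod (volume : Measure unitInterval)).map (fun p : Ω × unitInterval =>
      ((if (p.2 : ℝ) * w z.1 ≤ w p.1 then p.1 else z.1), (if (p.2 : ℝ) * w z.2 ≤ w p.1 then p.1 else z.2))))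
    (μ₀ : Measure (Ω × Ω)) [IsProbabilityMeasure μ₀] {f : Ω → ℝ} (hf : Measurable f) {a c : ℝ}
    (ha : ∀ x, a ≤ f x) (hc : ∀ x, f x ≤ c) (i j : ℕ) :
    ∫ z, |f ((z i).1) - f ((z i).2)| * |f ((z j).1) - f ((z j).2)|
        ∂(Kernel.trajMeasure (X := fun _ : ℕ => Ω × Ω) μ₀
          (fun n : ℕ => Khat.comap (fun h : (i : ↥(Finset.Iic n)) → Ω × Ω => h ⟨n, Finset.mem_Iic.2 le_rfl⟩)
            (measurable_pi_apply _))) ≤ (1 - (w x₀)⁻¹) ^ max i j * (c - a) ^ 2 := by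
  set P := Kernel.trajMeasure (X := fun _ : ℕ => Ω × Ω) μ₀
        (fun n : ℕ => Khat.comap (fun h : (i : ↥(Finset.Iic n)) → Ω × Ω => h ⟨n, Finset.mem_Iic.2 le_rfl⟩)
          (measurable_pi_apply _)) with hP
  have hDm : ∀ n, Measurable (fun z : ℕ → Ω × Ω => |f ((z n).1) - f ((z n).2)|) := fun n =>
    ((hf.comp (measurable_fst.comp (measurable_pi_apply n))).sub
      (hf.comp (measurable_snd.comp (measurable_pi_apply n)))).abs
  have hDb : ∀ n (z : ℕ → Ω × Ω), |f ((z n).1) - f ((z n).2)| ≤ c - a := by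
    intro n z
    have h1 := ha ((z n).1); have h2 := hc ((z n).1); have h3 := ha ((z n).2); have h4 := hc ((z n).2)
    exact abs_le.2 ⟨by linarith, by linarith⟩
  have hca : 0 ≤ c - a := (abs_nonneg _).trans (hDb 0 (fun _ => (x₀, x₀)))
  have hDi : ∀ n, Integrable (fun z : ℕ → Ω × Ω => |f ((z n).1) - f ((z n).2)|) P := fun n =>
    integrable_of_bounded P (hDm n) (fun z => by rw [abs_abs]; exact hDb n z)
  have hPi : Integrable (fun z : ℕ → Ω × Ω => |f ((z i).1) - f ((z i).2)| * |f ((z j).1) - f ((z j).2)|) P :=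
    integrable_of_bounded P ((hDm i).mul (hDm j)) (C := (c - a) * (c - a)) (fun z => by
      rw [abs_mul, abs_abs, abs_abs]
      exact mul_le_mul (hDb i z) (hDb j z) (abs_nonneg _) hca)
  rcases le_total i j with hij | hji
  · rw [max_eq_right hij]
    calc ∫ z, |f ((z i).1) - f ((z i).2)| * |f ((z j).1) - f ((z j).2)| ∂P
        ≤ ∫ z, (c - a) * |f ((z j).1) - f ((z j).2)| ∂P :=
          integral_mono hPi ((hDi j).const_mul _) (fun z => mul_le_mul_of_nonneg_right (hDb i z) (abs_nonneg _))
      _ = (c - a) * ∫ z, |f ((z j).1) - f ((z j).2)| ∂P := integral_const_mul _ _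
      _ ≤ (c - a) * ((1 - (w x₀)⁻¹) ^ j * (c - a)) :=
          mul_le_mul_of_nonneg_left (crnLag_integral_abs_diff_le hw0 hmax Khat hK μ₀ hf ha hc j) hca
      _ = (1 - (w x₀)⁻¹) ^ j * (c - a) ^ 2 := by ring
  · rw [max_eq_left hji]
    calc ∫ z, |f ((z i).1) - f ((z i).2)| * |f ((z j).1) - f ((z j).2)| ∂P
        ≤ ∫ z, (c - a) * |f ((z i).1) - f ((z i).2)| ∂P :=
          integral_mono hPi ((hDi i).const_mul _) (fun z => by
            rw [mul_comm (c - a)]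
            exact mul_le_mul_of_nonneg_left (hDb j z) (abs_nonneg _))
      _ = (c - a) * ∫ z, |f ((z i).1) - f ((z i).2)| ∂P := integral_const_mul _ _
      _ ≤ (c - a) * ((1 - (w x₀)⁻¹) ^ i * (c - a)) :=
          mul_le_mul_of_nonneg_left (crnLag_integral_abs_diff_le hw0 hmax Khat hK μ₀ hf ha hc i) hca
      _ = (1 - (w x₀)⁻¹) ^ i * (c - a) ^ 2 := by ring

/-- **THE SECOND MOMENT OF THE SUMMED CORRECTIONS**: `w` measurable (a `Fact`), positive, normalised, maximal at `x₀`
(`W = w(x₀)`, `r = 1 − 1/W`); `K̂` a CRN pair kernel; `a ≤ f ≤ c` measurable.  For every initial coupling `μ̂₀`, every `k`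
and every `N`: `E[(Σ_{n<N}|f(X′_{k+n}) − f(Y_{k+n})|)²] ≤ r^k·(c − a)²·W(2W − 1)`. [ours] -/
theorem crnLag_integral_sq_sum_abs_le [Fact (Measurable w)] (hw0 : ∀ y, 0 < w y) {x₀ : Ω} (hmax : ∀ y, w y ≤ w x₀)
    [IsProbabilityMeasure (q.withDensity fun y => ENNReal.ofReal (w y))]
    (Khat : Kernel (Ω × Ω) (Ω × Ω)) [IsMarkovKernel Khat]
    (hK : ∀ z : Ω × Ω, Khat z = (q.prod (volume : Measure unitInterval)).map (fun p : Ω × unitInterval =>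
      ((if (p.2 : ℝ) * w z.1 ≤ w p.1 then p.1 else z.1), (if (p.2 : ℝ) * w z.2 ≤ w p.1 then p.1 else z.2))))
    (μ₀ : Measure (Ω × Ω)) [IsProbabilityMeasure μ₀] {f : Ω → ℝ} (hf : Measurable f) {a c : ℝ}
    (ha : ∀ x, a ≤ f x) (hc : ∀ x, f x ≤ c) (k N : ℕ) :
    ∫ z, (∑ n ∈ Finset.range N, |f ((z (k + n)).1) - f ((z (k + n)).2)|) ^ 2
        ∂(Kernel.trajMeasure (X := fun _ : ℕ => Ω × Ω) μ₀
          (fun n : ℕ => Khat.comap (fun h : (i : ↥(Finset.Iic n)) → Ω × Ω => h ⟨n, Finset.mem_Iic.2 le_rfl⟩)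
            (measurable_pi_apply _))) ≤ (1 - (w x₀)⁻¹) ^ k * (c - a) ^ 2 * (w x₀ * (2 * w x₀ - 1)) := by
  set P := Kernel.trajMeasure (X := fun _ : ℕ => Ω × Ω) μ₀
        (fun n : ℕ => Khat.comap (fun h : (i : ↥(Finset.Iic n)) → Ω × Ω => h ⟨n, Finset.mem_Iic.2 le_rfl⟩)
          (measurable_pi_apply _)) with hP
  have hDm : ∀ n, Measurable (fun z : ℕ → Ω × Ω => |f ((z n).1) - f ((z n).2)|) := fun n =>
    ((hf.comp (measurable_fst.comp (measurable_pi_apply n))).sub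
      (hf.comp (measurable_snd.comp (measurable_pi_apply n)))).abs
  have hDb : ∀ n (z : ℕ → Ω × Ω), |f ((z n).1) - f ((z n).2)| ≤ c - a := by
    intro n z
    have h1 := ha ((z n).1); have h2 := hc ((z n).1); have h3 := ha ((z n).2); have h4 := hc ((z n).2)
    exact abs_le.2 ⟨by linarith, by linarith⟩
  have hca : 0 ≤ c - a := (abs_nonneg _).trans (hDb 0 (fun _ => (x₀, x₀)))
  have hPij : ∀ i j, Integrable
      (fun z : ℕ → Ω × Ω => |f ((z i).1) - f ((z i).2)| * |f ((z j).1) - f ((z j).2)|) P := fun i j =>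
    integrable_of_bounded P ((hDm i).mul (hDm j)) (C := (c - a) * (c - a)) (fun z => by
      rw [abs_mul, abs_abs, abs_abs]
      exact mul_le_mul (hDb i z) (hDb j z) (abs_nonneg _) hca)
  have hW : 1 ≤ w x₀ := one_le_of_mode (q := q) hmax
  have hW0 : (w x₀) ≠ 0 := (hw0 x₀).ne'
  have hr0 : 0 ≤ 1 - (w x₀)⁻¹ := sub_nonneg.2 (inv_le_one_of_one_le₀ hW)
  have hr1 : 1 - (w x₀)⁻¹ < 1 := sub_lt_self _ (inv_pos.mpr (hw0 x₀))
  have hsq : ∀ z : ℕ → Ω × Ω, (∑ n ∈ range N, |f ((z (k + n)).1) - f ((z (k + n)).2)|) ^ 2 =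
      ∑ i ∈ range N, ∑ j ∈ range N,
        |f ((z (k + i)).1) - f ((z (k + i)).2)| * |f ((z (k + j)).1) - f ((z (k + j)).2)| := fun z => by
    rw [sq, sum_mul_sum]
  simp_rw [hsq]
  rw [integral_finsetSum _ (fun i _ => integrable_finsetSum _ (fun j _ => hPij (k + i) (k + j)))]
  calc ∑ i ∈ range N, ∫ z, ∑ j ∈ range N,
          |f ((z (k + i)).1) - f ((z (k + i)).2)| * |f ((z (k + j)).1) - f ((z (k + j)).2)| ∂P
      = ∑ i ∈ range N, ∑ j ∈ range N,
          ∫ z, |f ((z (k + i)).1) - f ((z (k + i)).2)| * |f ((z (k + j)).1) - f ((z (k + j)).2)| ∂P :=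
        sum_congr rfl (fun i _ => integral_finsetSum _ (fun j _ => hPij (k + i) (k + j)))
    _ ≤ ∑ i ∈ range N, ∑ j ∈ range N, (1 - (w x₀)⁻¹) ^ (k + max i j) * (c - a) ^ 2 :=
        sum_le_sum fun i _ => sum_le_sum fun j _ => by
          have h := crnLag_integral_abs_mul_abs_le hw0 hmax Khat hK μ₀ hf ha hc (k + i) (k + j)
          rwa [max_add_add_left] at h
    _ = (1 - (w x₀)⁻¹) ^ k * (c - a) ^ 2 * ∑ i ∈ range N, ∑ j ∈ range N, (1 - (w x₀)⁻¹) ^ max i j := by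
        rw [mul_sum]
        refine sum_congr rfl fun i _ => ?_
        rw [mul_sum]
        refine sum_congr rfl fun j _ => ?_
        rw [pow_add]
        ring
    _ ≤ (1 - (w x₀)⁻¹) ^ k * (c - a) ^ 2 * ((1 + (1 - (w x₀)⁻¹)) / (1 - (1 - (w x₀)⁻¹)) ^ 2) :=
        mul_le_mul_of_nonneg_left (sum_sum_pow_max_le hr0 hr1 N) (by positivity)
    _ = (1 - (w x₀)⁻¹) ^ k * (c - a) ^ 2 * (w x₀ * (2 * w x₀ - 1)) := by
        congr 1
        field_simp
        ring

/-- **The same bound for the square of the signed sum**: `E[(Σ_{n<N}(f(X′_{k+n}) − f(Y_{k+n})))²] ≤ r^k·(c − a)²·W(2W − 1)`.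
[ours] -/
theorem crnLag_integral_sq_sum_le [Fact (Measurable w)] (hw0 : ∀ y, 0 < w y) {x₀ : Ω} (hmax : ∀ y, w y ≤ w x₀)
    [IsProbabilityMeasure (q.withDensity fun y => ENNReal.ofReal (w y))]
    (Khat : Kernel (Ω × Ω) (Ω × Ω)) [IsMarkovKernel Khat]
    (hK : ∀ z : Ω × Ω, Khat z = (q.prod (volume : Measure unitInterval)).map (fun p : Ω × unitInterval =>
      ((if (p.2 : ℝ) * w z.1 ≤ w p.1 then p.1 else z.1), (if (p.2 : ℝ) * w z.2 ≤ w p.1 then p.1 else z.2))))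
    (μ₀ : Measure (Ω × Ω)) [IsProbabilityMeasure μ₀] {f : Ω → ℝ} (hf : Measurable f) {a c : ℝ}
    (ha : ∀ x, a ≤ f x) (hc : ∀ x, f x ≤ c) (k N : ℕ) :
    ∫ z, (∑ n ∈ Finset.range N, (f ((z (k + n)).1) - f ((z (k + n)).2))) ^ 2
        ∂(Kernel.trajMeasure (X := fun _ : ℕ => Ω × Ω) μ₀
          (fun n : ℕ => Khat.comap (fun h : (i : ↥(Finset.Iic n)) → Ω × Ω => h ⟨n, Finset.mem_Iic.2 le_rfl⟩)
            (measurable_pi_apply _))) ≤ (1 - (w x₀)⁻¹) ^ k * (c - a) ^ 2 * (w x₀ * (2 * w x₀ - 1)) := by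
  set P := Kernel.trajMeasure (X := fun _ : ℕ => Ω × Ω) μ₀
        (fun n : ℕ => Khat.comap (fun h : (i : ↥(Finset.Iic n)) → Ω × Ω => h ⟨n, Finset.mem_Iic.2 le_rfl⟩)
          (measurable_pi_apply _)) with hP
  have hDm' : ∀ n, Measurable (fun z : ℕ → Ω × Ω => f ((z n).1) - f ((z n).2)) := fun n =>
    (hf.comp (measurable_fst.comp (measurable_pi_apply n))).sub (hf.comp (measurable_snd.comp (measurable_pi_apply n)))
  have hDb : ∀ n (z : ℕ → Ω × Ω), |f ((z n).1) - f ((z n).2)| ≤ c - a := by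
    intro n z
    have h1 := ha ((z n).1); have h2 := hc ((z n).1); have h3 := ha ((z n).2); have h4 := hc ((z n).2)
    exact abs_le.2 ⟨by linarith, by linarith⟩
  have hSb : ∀ z : ℕ → Ω × Ω, |∑ n ∈ range N, (f ((z (k + n)).1) - f ((z (k + n)).2))| ≤
      ∑ n ∈ range N, |f ((z (k + n)).1) - f ((z (k + n)).2)| := fun z => abs_sum_le_sum_abs _ _
  have hAb : ∀ z : ℕ → Ω × Ω, ∑ n ∈ range N, |f ((z (k + n)).1) - f ((z (k + n)).2)| ≤ N * (c - a) := by
    intro z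
    refine (sum_le_sum fun n _ => hDb (k + n) z).trans_eq ?_
    rw [sum_const, card_range, nsmul_eq_mul]
  have hAnn : ∀ z : ℕ → Ω × Ω, 0 ≤ ∑ n ∈ range N, |f ((z (k + n)).1) - f ((z (k + n)).2)| := fun z =>
    sum_nonneg fun n _ => abs_nonneg _
  have h1i : Integrable (fun z : ℕ → Ω × Ω => (∑ n ∈ range N, (f ((z (k + n)).1) - f ((z (k + n)).2))) ^ 2) P :=
    integrable_of_bounded P ((Finset.measurable_sum _ fun n _ => hDm' (k + n)).pow_const 2) (C := (N * (c - a)) ^ 2)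
      (fun z => by
        rw [abs_pow]
        exact pow_le_pow_left₀ (abs_nonneg _) ((hSb z).trans (hAb z)) 2)
  have h2i : Integrable (fun z : ℕ → Ω × Ω => (∑ n ∈ range N, |f ((z (k + n)).1) - f ((z (k + n)).2)|) ^ 2) P :=
    integrable_of_bounded P ((Finset.measurable_sum _ fun n _ => (hDm' (k + n)).abs).pow_const 2)
      (C := (N * (c - a)) ^ 2) (fun z => by
        rw [abs_pow, abs_of_nonneg (hAnn z)]
        exact pow_le_pow_left₀ (hAnn z) (hAb z) 2)
  refine le_trans (integral_mono h1i h2i fun z => ?_) (crnLag_integral_sq_sum_abs_le hw0 hmax Khat hK μ₀ hf ha hc k N)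
  dsimp only
  rw [← sq_abs]
  exact pow_le_pow_left₀ (abs_nonneg _) (hSb z) 2

/-! ## §2 The truncated estimator: its mean is exactly `E f(Y_{k+N})` -/

/-- **`E[f(Y_k) + Σ_{n<N} D_{k+n}] = (μ₂K^{k+N}) f`** under the lag condition `μ̂₀∘fst⁻¹ = μ₂K`: the `N` corrections move
the plain estimate's time from `k` to `k + N`, exactly. [ours] -/
theorem crnLag_truncated_integral_eq [Fact (Measurable w)] (hw0 : ∀ y, 0 < w y) (Khat : Kernel (Ω × Ω) (Ω × Ω))
    [IsMarkovKernel Khat]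
    (hK : ∀ z : Ω × Ω, Khat z = (q.prod (volume : Measure unitInterval)).map (fun p : Ω × unitInterval =>
      ((if (p.2 : ℝ) * w z.1 ≤ w p.1 then p.1 else z.1), (if (p.2 : ℝ) * w z.2 ≤ w p.1 then p.1 else z.2))))
    (μ₀ : Measure (Ω × Ω)) [IsProbabilityMeasure μ₀]
    (hlag : μ₀.map Prod.fst = (μ₀.map Prod.snd).bind (indepMH q w)) {f : Ω → ℝ} (hf : Measurable f) {C : ℝ}
    (hC : ∀ x, |f x| ≤ C) (k N : ℕ) :
    ∫ z, (f ((z k).2) + ∑ n ∈ Finset.range N, (f ((z (k + n)).1) - f ((z (k + n)).2)))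
        ∂(Kernel.trajMeasure (X := fun _ : ℕ => Ω × Ω) μ₀
          (fun n : ℕ => Khat.comap (fun h : (i : ↥(Finset.Iic n)) → Ω × Ω => h ⟨n, Finset.mem_Iic.2 le_rfl⟩)
            (measurable_pi_apply _))) =
      ∫ y, f y ∂((fun m : Measure Ω => m.bind (indepMH q w))^[k + N] (μ₀.map Prod.snd)) := by
  set P := Kernel.trajMeasure (X := fun _ : ℕ => Ω × Ω) μ₀
        (fun n : ℕ => Khat.comap (fun h : (i : ↥(Finset.Iic n)) → Ω × Ω => h ⟨n, Finset.mem_Iic.2 le_rfl⟩)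
          (measurable_pi_apply _)) with hP
  set u : ℕ → ℝ := fun M => ∫ y, f y ∂((fun m : Measure Ω => m.bind (indepMH q w))^[M] (μ₀.map Prod.snd)) with hu
  have hYi : Integrable (fun z : ℕ → Ω × Ω => f ((z k).2)) P :=
    integrable_of_bounded P (hf.comp (measurable_snd.comp (measurable_pi_apply k))) (fun z => hC _)
  have hDi : ∀ n, Integrable (fun z : ℕ → Ω × Ω => f ((z n).1) - f ((z n).2)) P := fun n =>
    integrable_of_bounded P ((hf.comp (measurable_fst.comp (measurable_pi_apply n))).sub
      (hf.comp (measurable_snd.comp (measurable_pi_apply n)))) (C := C + C) (fun z =>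
        (abs_sub _ _).trans (add_le_add (hC _) (hC _)))
  rw [integral_add hYi (integrable_finsetSum _ fun n _ => hDi (k + n)), integral_finsetSum _ fun n _ => hDi (k + n),
    crnLag_integral_snd_eq hw0 Khat hK μ₀ hf hC k]
  have hterm : ∀ n, ∫ z, (f ((z (k + n)).1) - f ((z (k + n)).2)) ∂P = u (k + n + 1) - u (k + n) := fun n =>
    crnLag_integral_diff_eq hw0 Khat hK μ₀ hlag hf hC (k + n)
  simp_rw [hterm]
  have htel : ∑ n ∈ range N, (u (k + n + 1) - u (k + n)) = u (k + N) - u k := by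
    have := Finset.sum_range_sub (fun n => u (k + n)) N
    simpa [Nat.add_assoc] using this
  rw [htel]
  ring

/-- **THE BIAS OF THE TRUNCATED ESTIMATOR IS THE BURN-IN BIAS AT TIME `k + N`**: with `a ≤ f ≤ c`, `w` maximal at `x₀`
(`r = 1 − 1/w(x₀)`): `E[f(Y_k) + Σ_{n<N} D_{k+n}] − π(f) ∈ [r^{k+N}·(a − π(f)), r^{k+N}·(c − π(f))]`. [ours] -/
theorem crnLag_truncated_bias_mem_Icc [Fact (Measurable w)] (hw0 : ∀ y, 0 < w y) {x₀ : Ω} (hmax : ∀ y, w y ≤ w x₀)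
    [IsProbabilityMeasure (q.withDensity fun y => ENNReal.ofReal (w y))]
    (Khat : Kernel (Ω × Ω) (Ω × Ω)) [IsMarkovKernel Khat]
    (hK : ∀ z : Ω × Ω, Khat z = (q.prod (volume : Measure unitInterval)).map (fun p : Ω × unitInterval =>
      ((if (p.2 : ℝ) * w z.1 ≤ w p.1 then p.1 else z.1), (if (p.2 : ℝ) * w z.2 ≤ w p.1 then p.1 else z.2))))
    (μ₀ : Measure (Ω × Ω)) [IsProbabilityMeasure μ₀]
    (hlag : μ₀.map Prod.fst = (μ₀.map Prod.snd).bind (indepMH q w)) {f : Ω → ℝ} (hf : Measurable f) {a c : ℝ}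
    (ha : ∀ x, a ≤ f x) (hc : ∀ x, f x ≤ c) (k N : ℕ) :
    ∫ z, (f ((z k).2) + ∑ n ∈ Finset.range N, (f ((z (k + n)).1) - f ((z (k + n)).2)))
        ∂(Kernel.trajMeasure (X := fun _ : ℕ => Ω × Ω) μ₀
          (fun n : ℕ => Khat.comap (fun h : (i : ↥(Finset.Iic n)) → Ω × Ω => h ⟨n, Finset.mem_Iic.2 le_rfl⟩)
            (measurable_pi_apply _))) - ∫ x, f x ∂(q.withDensity fun y => ENNReal.ofReal (w y)) ∈
      Set.Icc ((1 - (w x₀)⁻¹) ^ (k + N) * (a - ∫ x, f x ∂(q.withDensity fun y => ENNReal.ofReal (w y))))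
        ((1 - (w x₀)⁻¹) ^ (k + N) * (c - ∫ x, f x ∂(q.withDensity fun y => ENNReal.ofReal (w y)))) := by
  haveI : IsProbabilityMeasure (μ₀.map Prod.snd) := Measure.isProbabilityMeasure_map measurable_snd.aemeasurable
  have hC : ∀ x, |f x| ≤ max |a| |c| := fun x => abs_le_max_abs_abs (ha x) (hc x)
  rw [crnLag_truncated_integral_eq hw0 Khat hK μ₀ hlag hf hC k N]
  exact integral_iterate_bind_indepMH_mem_Icc (q := q) Fact.out hw0 hmax (k + N) (μ₀.map Prod.snd) hf ha hc

/-- **`|E[f(Y_k) + Σ_{n<N} D_{k+n}] − π(f)| ≤ r^{k+N}·(c − a)`** — geometrically small in the TOTAL work `k + N`; the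
`N = ∞` estimator is exactly unbiased (`IMHCoupledUnbiasedEstimator.crnLag_unbiased`). [ours] -/
theorem crnLag_truncated_bias_abs_le [Fact (Measurable w)] (hw0 : ∀ y, 0 < w y) {x₀ : Ω} (hmax : ∀ y, w y ≤ w x₀)
    [IsProbabilityMeasure (q.withDensity fun y => ENNReal.ofReal (w y))]
    (Khat : Kernel (Ω × Ω) (Ω × Ω)) [IsMarkovKernel Khat]
    (hK : ∀ z : Ω × Ω, Khat z = (q.prod (volume : Measure unitInterval)).map (fun p : Ω × unitInterval =>
      ((if (p.2 : ℝ) * w z.1 ≤ w p.1 then p.1 else z.1), (if (p.2 : ℝ) * w z.2 ≤ w p.1 then p.1 else z.2))))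
    (μ₀ : Measure (Ω × Ω)) [IsProbabilityMeasure μ₀]
    (hlag : μ₀.map Prod.fst = (μ₀.map Prod.snd).bind (indepMH q w)) {f : Ω → ℝ} (hf : Measurable f) {a c : ℝ}
    (ha : ∀ x, a ≤ f x) (hc : ∀ x, f x ≤ c) (k N : ℕ) :
    |∫ z, (f ((z k).2) + ∑ n ∈ Finset.range N, (f ((z (k + n)).1) - f ((z (k + n)).2)))
        ∂(Kernel.trajMeasure (X := fun _ : ℕ => Ω × Ω) μ₀
          (fun n : ℕ => Khat.comap (fun h : (i : ↥(Finset.Iic n)) → Ω × Ω => h ⟨n, Finset.mem_Iic.2 le_rfl⟩)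
            (measurable_pi_apply _))) - ∫ x, f x ∂(q.withDensity fun y => ENNReal.ofReal (w y))| ≤
      (1 - (w x₀)⁻¹) ^ (k + N) * (c - a) := by
  haveI : IsProbabilityMeasure (μ₀.map Prod.snd) := Measure.isProbabilityMeasure_map measurable_snd.aemeasurable
  have hC : ∀ x, |f x| ≤ max |a| |c| := fun x => abs_le_max_abs_abs (ha x) (hc x)
  rw [crnLag_truncated_integral_eq hw0 Khat hK μ₀ hlag hf hC k N]
  exact integral_iterate_bind_indepMH_abs_le (q := q) Fact.out hw0 hmax (k + N) (μ₀.map Prod.snd) hf ha hc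

end Summit.Ventures.LatticeQCDFlow.Exactness

end
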